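import Mathlib
import Summits.Ventures.HodgeRepro.Statements

/-!
# A second, structurally different proof of the sealed statement (b) `MuTable` (cross-check; seat p2, gen 7)

The landing proof (`MuTableProof.lean`) evaluates the two `Function.update`s with `simp`.  This file re-proves `MuTable`
WITHOUT `simp` and without any `Function.update` lemma: the slot evaluations `muSharp₂₃ δ μ S k` for `k = 0, 1, 2, 3` are
closed by `rfl` (the `Fin 4` literal comparisons inside `Function.update` reduce definitionally), the gauge identity by
`add_zero` / `zero_add`, idempotence through the closed-form vector `muSharp₂₃_eq_vec`, and the partition by a case split on
the relabelling bit `conjSwapAt`.  Same theorem name suffix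
`muTable_holds'` so that it can live next to the landing file.
-/

set_option autoImplicit false

namespace Summit.Ventures.HodgeRepro

open MuTable

namespace MuTableAlt

variable {L : Type} [Field L] [NumberField L] [NumberField.IsCMField L]

/-- Closed form of the double sharpening as a `Fin 4`-vector (every slot by definitional unfolding). -/
theorem muSharp₂₃_eq_vec (δ : L) (μ : Table L) (S : SeesawDatum L) :
    muSharp₂₃ δ μ S = ![μ S 0, μ S 0 + slotDelta δ S, μ S 0 + slotDelta₂ δ S, μ S 0 + slotDelta₃ δ S] := by
  funext k
  fin_cases k <;> rfl

/-- The partition `δ₂ + δ₃ = δ_S` at a place where the relabelling bit is set. -/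
theorem partition_of_conjSwapAt (δ : L) (S : SeesawDatum L) (w : NumberField.InfinitePlace L) (h : conjSwapAt S w) :
    slotDelta₂ δ S w + slotDelta₃ δ S w = slotDelta δ S w ∧ slotDelta₂ δ S w * slotDelta₃ δ S w = 0 := by
  unfold slotDelta₂ slotDelta₃
  rw [if_pos h, if_pos h, add_zero, mul_zero]
  exact ⟨rfl, rfl⟩

/-- The partition `δ₂ + δ₃ = δ_S` at a place where the relabelling bit is not set. -/
theorem partition_of_not_conjSwapAt (δ : L) (S : SeesawDatum L) (w : NumberField.InfinitePlace L)
    (h : ¬ conjSwapAt S w) :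
    slotDelta₂ δ S w + slotDelta₃ δ S w = slotDelta δ S w ∧ slotDelta₂ δ S w * slotDelta₃ δ S w = 0 := by
  unfold slotDelta₂ slotDelta₃
  rw [if_neg h, if_neg h, zero_add, zero_mul]
  exact ⟨rfl, rfl⟩

end MuTableAlt

open MuTableAlt in
/-- **(b) `MuTable` holds** — second proof (no `simp`, no `Function.update` lemma). -/
theorem muTable_holds' : MuTable := by
  intro L _ _ _ δ _ _ S
  refine ⟨?_, ?_, ?_, ?_⟩
  · intro k
    fin_cases k
    · rfl
    · exact zero_add (slotDelta δ S)
    · exact zero_add (slotDelta₂ δ S)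
    · exact zero_add (slotDelta₃ δ S)
  · intro μ k
    fin_cases k
    · exact (add_zero (μ S 0)).symm
    · exact congrArg (fun t => μ S 0 + t) (zero_add (slotDelta δ S)).symm
    · exact congrArg (fun t => μ S 0 + t) (zero_add (slotDelta₂ δ S)).symm
    · exact congrArg (fun t => μ S 0 + t) (zero_add (slotDelta₃ δ S)).symm
  · intro μ
    calc muSharp₂₃ δ (muSharp₂₃ δ μ) S
        = ![muSharp₂₃ δ μ S 0, muSharp₂₃ δ μ S 0 + slotDelta δ S, muSharp₂₃ δ μ S 0 + slotDelta₂ δ S,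
            muSharp₂₃ δ μ S 0 + slotDelta₃ δ S] := muSharp₂₃_eq_vec δ (muSharp₂₃ δ μ) S
      _ = ![μ S 0, μ S 0 + slotDelta δ S, μ S 0 + slotDelta₂ δ S, μ S 0 + slotDelta₃ δ S] := rfl
      _ = muSharp₂₃ δ μ S := (muSharp₂₃_eq_vec δ μ S).symm
  · intro w
    by_cases h : conjSwapAt S w
    · exact partition_of_conjSwapAt δ S w h
    · exact partition_of_not_conjSwapAt δ S w h

end Summit.Ventures.HodgeRepro
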